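import Mathlib.Analysis.SpecialFunctions.Pow.Deriv
import Mathlib.Analysis.SpecialFunctions.Sqrt
import Mathlib.Analysis.Calculus.Deriv.Inv
import HarnessLib

/-!
# Bounds on the Bogoliubov–LHY integrand `G(t) = √(1+2t) - 1 - t + t²/2` and its radial profile

Topic `Literature/MathematicalPhysics/QuantumManyBody`, namespace `BoseGas` (provefact
`Literature.MathematicalPhysics.QuantumManyBody.BoseGas.Junge2026_neumannBox_pinnedLowerBound`;
first file of the Riemann-sum step of [FournaisEtAl2024, Lemma 8.1], companion of
`LeeHuangYangIntegral.lean`). After the Bogoliubov diagonalisation the second-order energy of the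
dilute Bose gas on the Neumann box is the mode sum `∑_{p ∈ (π/ℓ)ℕ₀³∖0} p² G(8πρ_z a/p²)` with
`G(t) = √(1+2t) - 1 - t + t²/2` [FournaisEtAl2024, proof of Lemma 8.1], to be compared with the
integral `∫ p²G(8πρa/p²) dp` (= `integral_bogoliubov`, `lhy_correction_integral`). The comparison
("one easily checks") rests on the elementary bounds printed there — `G(t) ≤ Ct³`, `G(t) ≤ Ct²`,
`|G'(t)| ≤ C(1+t)` — and on the resulting size and smoothness of the radial profile
`f(r) = r²G(1/r²) = √(r⁴+2r²) - r² - 1 + 1/(2r²)` (the `μ = 1` case of the integrand of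
`integral_bogoliubov`). Everything is algebraic in `s = √(1+2t) ≥ 1`:
`G = (s-1)³(s+3)/8`, `G' = (s-1)²(s+2)/(2s)`.

* `lhyG_eq_factor`, `lhyG_nonneg`, `lhyG_le_half_cube` (`G ≤ t³/2`), `lhyG_le_half_sq`
  (`G ≤ t²/2`), `hasDerivAt_lhyG`, `lhyG_deriv_nonneg`, `lhyG_deriv_le` (`0 ≤ G' ≤ t`);
* `bogoliubovProfile_eq_sq_mul_lhyG` (`f(r) = r²G(r⁻²)`), `bogoliubovProfile_nonneg`,
  `bogoliubovProfile_le_inv_sq` (`f ≤ 1/(2r²)`), `bogoliubovProfile_le_inv_pow_four`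
  (`f ≤ 1/(2r⁴)`), `hasDerivAt_bogoliubovProfile` (`f' = 2(r²+1)/√(r²+2) - 2r - r⁻³`),
  `abs_bogoliubovProfile_deriv_le_of_le_one` (`|f'| ≤ 6r⁻³` on `(0,1]`),
  `abs_bogoliubovProfile_deriv_le_of_one_le` (`|f'| ≤ 3r⁻⁵` on `[1,∞)`).

No definitions (the functions are written out).

## References

* [FournaisEtAl2024] S. Fournais, L. Junge, T. Girardot, L. Morin, M. Olivieri, A. Triay, *The free
  energy of dilute Bose gases at low temperatures interacting via strong potentials*,
  arXiv:2408.14222, Ann. Henri Poincaré (2026): Lemma 8.1 and its proof.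
-/

noncomputable section

open Real

namespace Literature.MathematicalPhysics.QuantumManyBody.BoseGas

/-! ### `G(t) = √(1+2t) - 1 - t + t²/2` in terms of `s = √(1+2t)` -/

/-- `s = √(1+2t)` satisfies `s² = 1 + 2t` and `s ≥ 1` for `t ≥ 0`. [folklore] -/
theorem sqrt_one_add_two_mul_sq {t : ℝ} (ht : 0 ≤ t) :
    Real.sqrt (1 + 2 * t) ^ 2 = 1 + 2 * t ∧ 1 ≤ Real.sqrt (1 + 2 * t) := by
  exact ⟨Real.sq_sqrt (by linarith), Real.one_le_sqrt.2 (by linarith)⟩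

/-- **`G = (s-1)³(s+3)/8`**, `s = √(1+2t)`. [cite: FournaisEtAl2024, Lemma 8.1 (proof)] -/
theorem lhyG_eq_factor {t : ℝ} (ht : 0 ≤ t) :
    Real.sqrt (1 + 2 * t) - 1 - t + t ^ 2 / 2 =
      (Real.sqrt (1 + 2 * t) - 1) ^ 3 * (Real.sqrt (1 + 2 * t) + 3) / 8 := by
  obtain ⟨hs2, _⟩ := sqrt_one_add_two_mul_sq ht
  have htc : t = (Real.sqrt (1 + 2 * t) ^ 2 - 1) / 2 := by rw [hs2]; ring
  generalize Real.sqrt (1 + 2 * t) = s at hs2 htc ⊢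
  rw [htc]; ring

/-- **`G ≥ 0`.** [cite: FournaisEtAl2024, Lemma 8.1 (proof)] -/
theorem lhyG_nonneg {t : ℝ} (ht : 0 ≤ t) : 0 ≤ Real.sqrt (1 + 2 * t) - 1 - t + t ^ 2 / 2 := by
  rw [lhyG_eq_factor ht]
  obtain ⟨_, hs1⟩ := sqrt_one_add_two_mul_sq ht
  have h1 : 0 ≤ Real.sqrt (1 + 2 * t) - 1 := by linarith
  positivity

/-- **`G(t) ≤ t³/2`** ("`G(t) ≤ Ct³`"). [cite: FournaisEtAl2024, Lemma 8.1 (proof)] -/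
theorem lhyG_le_half_cube {t : ℝ} (ht : 0 ≤ t) :
    Real.sqrt (1 + 2 * t) - 1 - t + t ^ 2 / 2 ≤ t ^ 3 / 2 := by
  rw [lhyG_eq_factor ht]
  obtain ⟨hs2, hs1⟩ := sqrt_one_add_two_mul_sq ht
  have htc : t = (Real.sqrt (1 + 2 * t) ^ 2 - 1) / 2 := by rw [hs2]; ring
  generalize Real.sqrt (1 + 2 * t) = s at hs2 hs1 htc ⊢
  rw [htc]
  -- `(s-1)³(s+3)/8 ≤ ((s-1)(s+1)/2)³/2 = (s-1)³(s+1)³/16` iff `2(s+3) ≤ (s+1)³`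
  have h1 : 0 ≤ s - 1 := by linarith
  have h2 : 2 * (s + 3) ≤ (s + 1) ^ 3 := by nlinarith [h1, sq_nonneg (s - 1)]
  have h3 : 0 ≤ (s - 1) ^ 3 := by positivity
  have key : (s - 1) ^ 3 * (s + 3) / 8 ≤ (s - 1) ^ 3 * (s + 1) ^ 3 / 16 := by
    rw [div_le_div_iff₀ (by norm_num) (by norm_num)]
    nlinarith [mul_le_mul_of_nonneg_left h2 h3]
  calc (s - 1) ^ 3 * (s + 3) / 8 ≤ (s - 1) ^ 3 * (s + 1) ^ 3 / 16 := key
    _ = ((s ^ 2 - 1) / 2) ^ 3 / 2 := by ring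

/-- **`G(t) ≤ t²/2`** ("`G(t) ≤ Ct²`"). [cite: FournaisEtAl2024, Lemma 8.1 (proof)] -/
theorem lhyG_le_half_sq {t : ℝ} (ht : 0 ≤ t) :
    Real.sqrt (1 + 2 * t) - 1 - t + t ^ 2 / 2 ≤ t ^ 2 / 2 := by
  rw [lhyG_eq_factor ht]
  obtain ⟨hs2, hs1⟩ := sqrt_one_add_two_mul_sq ht
  have htc : t = (Real.sqrt (1 + 2 * t) ^ 2 - 1) / 2 := by rw [hs2]; ring
  generalize Real.sqrt (1 + 2 * t) = s at hs2 hs1 htc ⊢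
  rw [htc]
  -- `(s-1)³(s+3)/8 ≤ (s-1)²(s+1)²/8` iff `(s-1)(s+3) ≤ (s+1)²`
  have h1 : 0 ≤ s - 1 := by linarith
  have h3 : 0 ≤ (s - 1) ^ 2 := sq_nonneg _
  have h2 : (s - 1) * (s + 3) ≤ (s + 1) ^ 2 := by nlinarith
  calc (s - 1) ^ 3 * (s + 3) / 8 = (s - 1) ^ 2 * ((s - 1) * (s + 3)) / 8 := by ring
    _ ≤ (s - 1) ^ 2 * (s + 1) ^ 2 / 8 := by gcongr
    _ = ((s ^ 2 - 1) / 2) ^ 2 / 2 := by ring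

/-- **`G'(t) = 1/√(1+2t) - 1 + t`** for `t ≥ 0` (indeed for `1 + 2t > 0`). [folklore] -/
theorem hasDerivAt_lhyG {t : ℝ} (ht : 0 ≤ t) :
    HasDerivAt (fun t => Real.sqrt (1 + 2 * t) - 1 - t + t ^ 2 / 2)
      ((Real.sqrt (1 + 2 * t))⁻¹ - 1 + t) t := by
  have h1 : HasDerivAt (fun t : ℝ => 1 + 2 * t) (2 * 1) t :=
    HasDerivAt.const_add 1 (HasDerivAt.const_mul 2 (hasDerivAt_id' t))
  have hpos : 1 + 2 * t ≠ 0 := by linarith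
  have h2 : HasDerivAt (fun t : ℝ => Real.sqrt (1 + 2 * t)) (2 * 1 / (2 * Real.sqrt (1 + 2 * t))) t :=
    HasDerivAt.sqrt h1 hpos
  have h3 : HasDerivAt (fun t : ℝ => t ^ 2 / 2) (((2 : ℕ) : ℝ) * t ^ (2 - 1) / 2) t :=
    HasDerivAt.div_const (hasDerivAt_pow 2 t) 2
  have h4 : HasDerivAt (fun t => Real.sqrt (1 + 2 * t) - 1 - t + t ^ 2 / 2)
      (2 * 1 / (2 * Real.sqrt (1 + 2 * t)) - 0 - 1 + ((2 : ℕ) : ℝ) * t ^ (2 - 1) / 2) t :=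
    HasDerivAt.fun_add (HasDerivAt.fun_sub (HasDerivAt.fun_sub h2 (hasDerivAt_const t 1))
      (hasDerivAt_id' t)) h3
  refine h4.congr_deriv ?_
  have hs : Real.sqrt (1 + 2 * t) ≠ 0 := (Real.sqrt_pos.2 (by linarith)).ne'
  field_simp
  ring

/-- **`G' = (s-1)²(s+2)/(2s) ≥ 0`**: `G` is non-decreasing. [cite: FournaisEtAl2024, Lemma 8.1 (proof)] -/
theorem lhyG_deriv_nonneg {t : ℝ} (ht : 0 ≤ t) : 0 ≤ (Real.sqrt (1 + 2 * t))⁻¹ - 1 + t := by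
  obtain ⟨hs2, hs1⟩ := sqrt_one_add_two_mul_sq ht
  have htc : t = (Real.sqrt (1 + 2 * t) ^ 2 - 1) / 2 := by rw [hs2]; ring
  generalize Real.sqrt (1 + 2 * t) = s at hs2 hs1 htc ⊢
  have hs0 : 0 < s := by linarith
  rw [htc]
  have key : s⁻¹ - 1 + (s ^ 2 - 1) / 2 = (s - 1) ^ 2 * (s + 2) / (2 * s) := by
    field_simp; ring
  rw [key]
  positivity

/-- **`G'(t) ≤ t`** (so `|G'(t)| ≤ C(1+t)`). [cite: FournaisEtAl2024, Lemma 8.1 (proof)] -/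
theorem lhyG_deriv_le {t : ℝ} (ht : 0 ≤ t) : (Real.sqrt (1 + 2 * t))⁻¹ - 1 + t ≤ t := by
  obtain ⟨_, hs1⟩ := sqrt_one_add_two_mul_sq ht
  have : (Real.sqrt (1 + 2 * t))⁻¹ ≤ 1 := inv_le_one_of_one_le₀ hs1
  linarith

/-! ### The radial profile `f(r) = √(r⁴+2r²) - r² - 1 + 1/(2r²) = r²G(r⁻²)` -/

/-- `√(r⁴ + 2r²) = r√(r² + 2) = r²√(1 + 2r⁻²)` for `r > 0`. [folklore] -/
theorem sqrt_pow_four_add {r : ℝ} (hr : 0 < r) :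
    Real.sqrt (r ^ 4 + 2 * r ^ 2) = r ^ 2 * Real.sqrt (1 + 2 * (r ^ 2)⁻¹) := by
  have h : r ^ 4 + 2 * r ^ 2 = (r ^ 2) ^ 2 * (1 + 2 * (r ^ 2)⁻¹) := by
    field_simp
  rw [h, Real.sqrt_mul (sq_nonneg _), Real.sqrt_sq (sq_nonneg _)]

/-- **`f(r) = r² G(r⁻²)`.** [cite: FournaisEtAl2024, Lemma 8.1 (proof)] -/
theorem bogoliubovProfile_eq_sq_mul_lhyG {r : ℝ} (hr : 0 < r) :
    Real.sqrt (r ^ 4 + 2 * r ^ 2) - r ^ 2 - 1 + 1 / (2 * r ^ 2) =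
      r ^ 2 * (Real.sqrt (1 + 2 * (r ^ 2)⁻¹) - 1 - (r ^ 2)⁻¹ + ((r ^ 2)⁻¹) ^ 2 / 2) := by
  rw [sqrt_pow_four_add hr]
  field_simp

/-- **`f ≥ 0`.** [cite: FournaisEtAl2024, Lemma 8.1 (proof)] -/
theorem bogoliubovProfile_nonneg {r : ℝ} (hr : 0 < r) :
    0 ≤ Real.sqrt (r ^ 4 + 2 * r ^ 2) - r ^ 2 - 1 + 1 / (2 * r ^ 2) := by
  rw [bogoliubovProfile_eq_sq_mul_lhyG hr]
  exact mul_nonneg (sq_nonneg _) (lhyG_nonneg (by positivity))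

/-- **`f(r) ≤ 1/(2r²)`** (from `G(t) ≤ t²/2`; the small-`r` behaviour). [cite: FournaisEtAl2024, Lemma 8.1 (proof)] -/
theorem bogoliubovProfile_le_inv_sq {r : ℝ} (hr : 0 < r) :
    Real.sqrt (r ^ 4 + 2 * r ^ 2) - r ^ 2 - 1 + 1 / (2 * r ^ 2) ≤ 1 / (2 * r ^ 2) := by
  rw [bogoliubovProfile_eq_sq_mul_lhyG hr]
  have h := lhyG_le_half_sq (t := (r ^ 2)⁻¹) (by positivity)
  have hr2 : 0 < r ^ 2 := by positivity
  calc r ^ 2 * (Real.sqrt (1 + 2 * (r ^ 2)⁻¹) - 1 - (r ^ 2)⁻¹ + ((r ^ 2)⁻¹) ^ 2 / 2)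
      ≤ r ^ 2 * (((r ^ 2)⁻¹) ^ 2 / 2) := by gcongr
    _ = 1 / (2 * r ^ 2) := by field_simp

/-- **`f(r) ≤ 1/(2r⁴)`** (from `G(t) ≤ t³/2`; the large-`r` decay). [cite: FournaisEtAl2024, Lemma 8.1 (proof)] -/
theorem bogoliubovProfile_le_inv_pow_four {r : ℝ} (hr : 0 < r) :
    Real.sqrt (r ^ 4 + 2 * r ^ 2) - r ^ 2 - 1 + 1 / (2 * r ^ 2) ≤ 1 / (2 * r ^ 4) := by
  rw [bogoliubovProfile_eq_sq_mul_lhyG hr]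
  have h := lhyG_le_half_cube (t := (r ^ 2)⁻¹) (by positivity)
  have hr2 : 0 < r ^ 2 := by positivity
  calc r ^ 2 * (Real.sqrt (1 + 2 * (r ^ 2)⁻¹) - 1 - (r ^ 2)⁻¹ + ((r ^ 2)⁻¹) ^ 2 / 2)
      ≤ r ^ 2 * (((r ^ 2)⁻¹) ^ 3 / 2) := by gcongr
    _ = 1 / (2 * r ^ 4) := by field_simp

/-- **`f'(r) = 2(r²+1)/√(r²+2) - 2r - r⁻³`** for `r > 0`. [folklore] -/
theorem hasDerivAt_bogoliubovProfile {r : ℝ} (hr : 0 < r) :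
    HasDerivAt (fun r => Real.sqrt (r ^ 4 + 2 * r ^ 2) - r ^ 2 - 1 + 1 / (2 * r ^ 2))
      (2 * (r ^ 2 + 1) / Real.sqrt (r ^ 2 + 2) - 2 * r - (r ^ 3)⁻¹) r := by
  have h4 : HasDerivAt (fun r : ℝ => r ^ 4) (((4 : ℕ) : ℝ) * r ^ (4 - 1)) r := hasDerivAt_pow 4 r
  have h2 : HasDerivAt (fun r : ℝ => r ^ 2) (((2 : ℕ) : ℝ) * r ^ (2 - 1)) r := hasDerivAt_pow 2 r
  have hpoly : HasDerivAt (fun r : ℝ => r ^ 4 + 2 * r ^ 2)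
      (((4 : ℕ) : ℝ) * r ^ (4 - 1) + 2 * (((2 : ℕ) : ℝ) * r ^ (2 - 1))) r :=
    HasDerivAt.fun_add h4 (HasDerivAt.const_mul 2 h2)
  have hpos : r ^ 4 + 2 * r ^ 2 ≠ 0 := by positivity
  have hsqrt := HasDerivAt.sqrt hpoly hpos
  have h2' : HasDerivAt (fun r : ℝ => 2 * r ^ 2) (2 * (((2 : ℕ) : ℝ) * r ^ (2 - 1))) r :=
    HasDerivAt.const_mul 2 h2
  have hinv := HasDerivAt.fun_inv h2' (by positivity : 2 * r ^ 2 ≠ 0)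
  have h := HasDerivAt.fun_add (HasDerivAt.fun_sub (HasDerivAt.fun_sub hsqrt h2)
    (hasDerivAt_const r 1)) hinv
  have h' : HasDerivAt (fun r => Real.sqrt (r ^ 4 + 2 * r ^ 2) - r ^ 2 - 1 + 1 / (2 * r ^ 2))
      ((((4 : ℕ) : ℝ) * r ^ (4 - 1) + 2 * (((2 : ℕ) : ℝ) * r ^ (2 - 1))) /
          (2 * Real.sqrt (r ^ 4 + 2 * r ^ 2)) - ((2 : ℕ) : ℝ) * r ^ (2 - 1) - 0 +
        -(2 * (((2 : ℕ) : ℝ) * r ^ (2 - 1))) / (2 * r ^ 2) ^ 2) r := by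
    simpa only [one_div] using h
  refine h'.congr_deriv ?_
  have hroot : Real.sqrt (r ^ 4 + 2 * r ^ 2) = r * Real.sqrt (r ^ 2 + 2) := by
    rw [show r ^ 4 + 2 * r ^ 2 = r ^ 2 * (r ^ 2 + 2) by ring, Real.sqrt_mul (sq_nonneg _),
      Real.sqrt_sq hr.le]
  rw [hroot]
  have hs : 0 < Real.sqrt (r ^ 2 + 2) := Real.sqrt_pos.2 (by positivity)
  push_cast
  field_simp
  ring

/-- **`|f'(r)| ≤ 6/r³` for `0 < r ≤ 1`.** [cite: FournaisEtAl2024, Lemma 8.1 (proof)] -/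
theorem abs_bogoliubovProfile_deriv_le_of_le_one {r : ℝ} (hr : 0 < r) (hr1 : r ≤ 1) :
    |2 * (r ^ 2 + 1) / Real.sqrt (r ^ 2 + 2) - 2 * r - (r ^ 3)⁻¹| ≤ 6 / r ^ 3 := by
  have hs2 : Real.sqrt (r ^ 2 + 2) ^ 2 = r ^ 2 + 2 := Real.sq_sqrt (by positivity)
  have hs1 : 1 ≤ Real.sqrt (r ^ 2 + 2) := Real.one_le_sqrt.2 (by nlinarith)
  have hr3 : 0 < r ^ 3 := by positivity
  have hr31 : r ^ 3 ≤ 1 := pow_le_one₀ hr.le hr1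
  -- `0 ≤ 2(r²+1)/√(r²+2) ≤ 4`, `0 ≤ 2r ≤ 2`, `r⁻³ ≥ 1`
  have hA : 0 ≤ 2 * (r ^ 2 + 1) / Real.sqrt (r ^ 2 + 2) := by positivity
  have hA' : 2 * (r ^ 2 + 1) / Real.sqrt (r ^ 2 + 2) ≤ 4 := by
    rw [div_le_iff₀ (by positivity)]; nlinarith
  have hinv : 1 ≤ (r ^ 3)⁻¹ := one_le_inv_iff₀.2 ⟨hr3, hr31⟩
  rw [abs_le]
  constructor
  · -- lower bound: `-(6/r³) ≤ A - 2r - r⁻³` since `A ≥ 0`, `2r ≤ 2 ≤ 2/r³`, `r⁻³ ≤ 1·/r³`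
    have : (r ^ 3)⁻¹ = 1 / r ^ 3 := inv_eq_one_div _
    rw [this]
    have h2r : 2 * r ≤ 2 / r ^ 3 := by rw [le_div_iff₀ hr3]; nlinarith
    have : -(6 / r ^ 3) = -(2 / r ^ 3) - 1 / r ^ 3 - 3 / r ^ 3 := by ring
    rw [this]
    have h3 : 0 ≤ 3 / r ^ 3 := by positivity
    linarith
  · have : (r ^ 3)⁻¹ = 1 / r ^ 3 := inv_eq_one_div _
    rw [this]
    have h4 : (4 : ℝ) ≤ 4 / r ^ 3 := by rw [le_div_iff₀ hr3]; nlinarith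
    have h1 : 0 ≤ 1 / r ^ 3 := by positivity
    have h2 : 0 ≤ 2 / r ^ 3 := by positivity
    have : 6 / r ^ 3 = 4 / r ^ 3 + 2 / r ^ 3 := by ring
    rw [this]
    nlinarith

/-- **`|f'(r)| ≤ 3/r⁵` for `r ≥ 1`** (the cancellation `2(r²+1)/√(r²+2) - 2r = 2/P`,
`P = √(r²+2)(r²+1+r√(r²+2)) ∈ [2r³, 2r³ + 6r]`). [cite: FournaisEtAl2024, Lemma 8.1 (proof)] -/
theorem abs_bogoliubovProfile_deriv_le_of_one_le {r : ℝ} (hr1 : 1 ≤ r) :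
    |2 * (r ^ 2 + 1) / Real.sqrt (r ^ 2 + 2) - 2 * r - (r ^ 3)⁻¹| ≤ 3 / r ^ 5 := by
  have hr : 0 < r := by linarith
  set s := Real.sqrt (r ^ 2 + 2) with hs_def
  have hs2 : s ^ 2 = r ^ 2 + 2 := Real.sq_sqrt (by positivity)
  have hsr : r ≤ s := (Real.le_sqrt hr.le (by positivity)).2 (by nlinarith)
  have hs0 : 0 < s := hr.trans_le hsr
  have hsr' : s ≤ r + r⁻¹ := by
    rw [hs_def, Real.sqrt_le_left (by positivity)]
    have : (r + r⁻¹) ^ 2 = r ^ 2 + 2 + (r⁻¹) ^ 2 := by field_simp; ring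
    rw [this]; nlinarith [sq_nonneg r⁻¹]
  -- the cancellation
  set P := s * (r ^ 2 + 1 + r * s) with hP
  have hP0 : 0 < P := by positivity
  have hcancel : 2 * (r ^ 2 + 1) / s - 2 * r = 2 / P := by
    rw [hP]
    field_simp
    nlinarith [hs2]
  have hPlow : 2 * r ^ 3 ≤ P := by
    rw [hP]; nlinarith [mul_le_mul hsr hsr hr.le hs0.le, hsr, hr]
  have hPup : P ≤ 2 * r ^ 3 + 6 * r := by
    have hri : r⁻¹ ≤ 1 := inv_le_one_of_one_le₀ hr1
    have hri0 : 0 < r⁻¹ := by positivity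
    rw [hP]
    have h1 : s * (r ^ 2 + 1 + r * s) ≤ (r + r⁻¹) * (r ^ 2 + 1 + r * (r + r⁻¹)) := by
      apply mul_le_mul hsr' _ (by positivity) (by positivity)
      nlinarith
    have h2 : (r + r⁻¹) * (r ^ 2 + 1 + r * (r + r⁻¹)) = 2 * r ^ 3 + 4 * r + 2 * r⁻¹ := by
      field_simp; ring
    rw [h2] at h1
    nlinarith
  rw [hcancel]
  -- `|2/P - 1/r³| = (P - 2r³)·/(P r³)`? we have `2/P ≤ 1/r³`, so the expression is `≤ 0`
  have hr3 : 0 < r ^ 3 := by positivity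
  have hr5 : 0 < r ^ 5 := by positivity
  have hle : 2 / P ≤ (r ^ 3)⁻¹ := by
    rw [inv_eq_one_div, div_le_div_iff₀ hP0 hr3]; linarith
  rw [abs_of_nonpos (by linarith), neg_sub]
  -- `1/r³ - 2/P = (P - 2r³)/(P r³) ≤ 6r/(2r³·r³) = 3/r⁵`
  have key : (r ^ 3)⁻¹ - 2 / P = (P - 2 * r ^ 3) / (P * r ^ 3) := by
    field_simp
  rw [key, div_le_div_iff₀ (by positivity) hr5]
  calc (P - 2 * r ^ 3) * r ^ 5 ≤ 6 * r * r ^ 5 := by gcongr; linarith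
    _ = 3 * (2 * r ^ 3 * r ^ 3) := by ring
    _ ≤ 3 * (P * r ^ 3) := by gcongr

end Literature.MathematicalPhysics.QuantumManyBody.BoseGas

end
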